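import Summits.Ventures.LatticeQCDFlow.Scoring.ChainLagProductACov
import Summits.Ventures.LatticeQCDFlow.Scoring.ChainWindowFunctionalSLLN
import Summits.Ventures.LatticeQCDFlow.Scoring.MadrasSokalRatioCLT

/-!
# ESTIMATING THE ASYMPTOTIC VARIANCE OF `τ̂_W` ON CHAIN DATA: the windowed (truncated) Bartlett-type
# plug-in estimator of `Σ` is almost surely consistent for the truncated matrix `Σ_K`, from EVERY initial
# law, and `Σ_K → Σ` as the truncation `K → ∞`

HONEST FRAMING: exact (Metropolis-corrected) sampling algorithms for lattice gauge theory;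
figures of merit are autocorrelation/cost numbers at stated couplings and volumes; no
continuum-physics claim.

Venture `LatticeQCDFlow` (cell pub-lqcd), sub-topic `Scoring`; FANOUT row 16 (`su2-base`), GEN-9.
NEW WORK of the cell, not a published result; definitions `chainLagProdCov` / `chainLagACovTrunc` (the
population cross moments and the truncated matrix) and `lagProdCovHat` / `lagACovTruncHat` (their
empirical counterparts, generic in the series); nothing is cited as a fact (windowed estimators of the
covariance of sample autocovariances — Bartlett 1946, Priestley 1981 §5.3; Geyer 1992's window
estimators for MCMC — NAMED ONLY).  An HONEST studentisation of GEN-9's `τ̂_W` CLT on chain data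
(`ChainTauIntWindowCLT`: asymptotic variance `ℓᵀ Σ ℓ`, `Σ = chainLagACov κ π f̄ W`) needs an estimator of
`Σ`.  Here: `Σ_K(s,t) = d(s,t) + Σ_{k<K} (c(s,t,k+1) + c(t,s,k+1))` (`c(s,t,k) = E_π[φ̄_s(Y_0) φ̄_t(Y_k)]`)
converges to `Σ(s,t)` as `K → ∞` (summability, `ChainLagProductACov`), and for every FIXED `K` the plug-in
estimator built from the observed path — lag products centred at the empirical autocovariances `Γ̂_N` —
converges to `Σ_K` ALMOST SURELY from every initial law (GEN-9's every-start strong law for window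
functionals, `ChainWindowFunctionalSLLN`); so does the plug-in quadratic form with the ESTIMATED gradient
`ℓ̂_N = tauHatGrad W (Γ̂_N)`.  The two limits are kept separate (no claim about `K = K_N → ∞`).

## Content (`κ` Markov, `π` invariant, `(nHit κ m)(z,·) ≥ ε ν` for all `z`, `ε ≠ 0`, `0 < m`; `|f| ≤ C`
## measurable, `f̄ = f − ∫ f dπ`, `X_i = f̄(x_i)`, `C(t) = autocov κ π f̄ t`; `μ₀` ANY initial law)

* `chainLagProdCov κ π g W s t k` [ours] — `c(s,t,k) = E_π[(g(X_0)g(X_s) − C(s))(g(X_k)g(X_{k+t}) − C(t))]`;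
  `chainLagACovTrunc … K s t` [ours] — `Σ_K(s,t)`; `chainLagACov_eq_tsum`;
  **`tendsto_chainLagACovTrunc_of_nHit`** — `Σ_K(s,t) → Σ(s,t)` as `K → ∞`.
* `lagProdCovHat X N s t k`, `lagACovTruncHat X N K s t` [ours] — the empirical cross moments centred at
  `acovHat X N ·`, and the truncated plug-in matrix; `lagProdCovHat_eq` (exact expansion).
* **`ae_tendsto_lagProdCovHat_chain_of_nHit`** — `ĉ_N(s,t,k) → c(s,t,k)` `P_{μ₀}`-a.s.;
  **`ae_tendsto_lagACovTruncHat_chain_of_nHit`** — `Σ̂_{N,K}(s,t) → Σ_K(s,t)` a.s., all `K, s, t` at once;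
  **`ae_tendsto_pluginVariance_chain_of_nHit`** — with `ℓ̂_N = tauHatGrad W (Γ̂_N(t))_t` (`C(0) ≠ 0`):
  `Σ_s Σ_t ℓ̂_s ℓ̂_t Σ̂_{N,K}(s,t) → Σ_s Σ_t ℓ_s ℓ_t Σ_K(s,t)` a.s.

NOT CLAIMED: a data-driven truncation `K_N → ∞` (uniformity in `K`); the studentised CLT with limit
`N(0,1)` (with fixed `K` the studentised limit variance is `ℓᵀΣℓ / ℓᵀΣ_Kℓ`); positivity of `ℓᵀ Σ_K ℓ`; rates.
-/

noncomputable section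

open MeasureTheory ProbabilityTheory Filter Finset Preorder WithLp
open scoped ENNReal Topology RealInnerProductSpace
open Summit.Ventures.LatticeQCDFlow.Exactness Summit.Ventures.LatticeQCDFlow.Exactness.GeneralNCMC

namespace Summit.Ventures.LatticeQCDFlow.Scoring

/-! ## The empirical cross moments (generic in the series) -/

section Empirical

variable {Ω : Type*}

/-- The empirical lag-`k` cross moment of the lag-`s` and lag-`t` products of a series, centred at the
empirical autocovariances: `ĉ_N(s,t,k) = (1/N) Σ_{i<N} (X_iX_{i+s} − Γ̂_N(s)) (X_{i+k}X_{i+k+t} − Γ̂_N(t))`. [ours] -/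
def lagProdCovHat (X : ℕ → Ω → ℝ) (N s t k : ℕ) : Ω → ℝ := fun ω =>
  (∑ i ∈ range N, (X i ω * X (i + s) ω - acovHat X N s ω) * (X (i + k) ω * X (i + k + t) ω - acovHat X N t ω)) / N

/-- The truncated plug-in matrix: `Σ̂_{N,K}(s,t) = ĉ_N(s,t,0) + Σ_{k<K} (ĉ_N(s,t,k+1) + ĉ_N(t,s,k+1))`. [ours] -/
def lagACovTruncHat (X : ℕ → Ω → ℝ) (N K s t : ℕ) : Ω → ℝ := fun ω =>
  lagProdCovHat X N s t 0 ω + ∑ k ∈ range K, (lagProdCovHat X N s t (k + 1) ω + lagProdCovHat X N t s (k + 1) ω)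

/-- **Exact expansion**: `ĉ_N(s,t,k) = (1/N) Σ_{i<N} X_iX_{i+s}X_{i+k}X_{i+k+t} − Γ̂_N(s) · (1/N) Σ_{i<N} X_{i+k}X_{i+k+t}`. -/
theorem lagProdCovHat_eq (X : ℕ → Ω → ℝ) (N s t k : ℕ) (ω : Ω) :
    lagProdCovHat X N s t k ω
      = (∑ i ∈ range N, X i ω * X (i + s) ω * (X (i + k) ω * X (i + k + t) ω)) / N
        - acovHat X N s ω * ((∑ i ∈ range N, X (i + k) ω * X (i + k + t) ω) / N) := by
  rcases Nat.eq_zero_or_pos N with hN | hN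
  · subst hN
    simp [lagProdCovHat]
  · have hNR : (N : ℝ) ≠ 0 := by exact_mod_cast hN.ne'
    have hA : (∑ i ∈ range N, X i ω * X (i + s) ω) = N * acovHat X N s ω := by
      rw [acovHat_apply, mul_div_cancel₀ _ hNR]
    simp only [lagProdCovHat]
    have hexp : ∑ i ∈ range N, (X i ω * X (i + s) ω - acovHat X N s ω)
        * (X (i + k) ω * X (i + k + t) ω - acovHat X N t ω)
      = ∑ i ∈ range N, X i ω * X (i + s) ω * (X (i + k) ω * X (i + k + t) ω)
        - acovHat X N t ω * ∑ i ∈ range N, X i ω * X (i + s) ω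
        - acovHat X N s ω * ∑ i ∈ range N, X (i + k) ω * X (i + k + t) ω
        + N * (acovHat X N s ω * acovHat X N t ω) := by
      rw [mul_sum, mul_sum, ← sum_sub_distrib, ← sum_sub_distrib]
      have : ∀ i ∈ range N, (X i ω * X (i + s) ω - acovHat X N s ω)
          * (X (i + k) ω * X (i + k + t) ω - acovHat X N t ω)
        = X i ω * X (i + s) ω * (X (i + k) ω * X (i + k + t) ω)
          - acovHat X N t ω * (X i ω * X (i + s) ω)
          - acovHat X N s ω * (X (i + k) ω * X (i + k + t) ω)
          + acovHat X N s ω * acovHat X N t ω := fun i _ => by ring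
      rw [sum_congr rfl this, sum_add_distrib, sum_const, card_range, nsmul_eq_mul]
    rw [hexp, hA]
    field_simp
    ring

end Empirical

/-! ## The population cross moments and the truncated matrix -/

section Population

variable {S : Type*} [MeasurableSpace S]

/-- The lag-`k` cross moment of the centred lag products under the stationary chain law:
`c(s,t,k) = E_π[(g(X_0)g(X_s) − C(s)) (g(X_k)g(X_{k+t}) − C(t))]` (read on the windows `Y_0`, `Y_k`). [ours] -/
def chainLagProdCov (κ : Kernel S S) [IsMarkovKernel κ] (π : Measure S) (g : S → ℝ) (W : ℕ)
    (s t : Fin (W + 1)) (k : ℕ) : ℝ :=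
  ∫ x, (g (windowPath W x 0 0) * g (windowPath W x 0 s) - autocov κ π g s)
      * (g (windowPath W x k 0) * g (windowPath W x k t) - autocov κ π g t)
    ∂(Kernel.trajMeasure (X := fun _ : ℕ => S) π
      (fun n : ℕ => κ.comap (fun hh : (i : ↥(Finset.Iic n)) → S => hh ⟨n, Finset.mem_Iic.2 le_rfl⟩)
        (measurable_pi_apply _)))

/-- The truncated asymptotic covariance matrix:
`Σ_K(s,t) = c(s,t,0) + Σ_{k<K} (c(s,t,k+1) + c(t,s,k+1))`. [ours] -/
def chainLagACovTrunc (κ : Kernel S S) [IsMarkovKernel κ] (π : Measure S) (g : S → ℝ) (W K : ℕ)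
    (s t : Fin (W + 1)) : ℝ :=
  chainLagProdCov κ π g W s t 0
    + ∑ k ∈ range K, (chainLagProdCov κ π g W s t (k + 1) + chainLagProdCov κ π g W t s (k + 1))

/-- `Σ(s,t) = c(s,t,0) + Σ'_{k} (c(s,t,k+1) + c(t,s,k+1))` (unfolding `chainLagACov`). -/
theorem chainLagACov_eq_tsum (κ : Kernel S S) [IsMarkovKernel κ] (π : Measure S) (g : S → ℝ) (W : ℕ)
    (s t : Fin (W + 1)) :
    chainLagACov κ π g W s t = chainLagProdCov κ π g W s t 0
      + ∑' k, (chainLagProdCov κ π g W s t (k + 1) + chainLagProdCov κ π g W t s (k + 1)) := rfl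

variable (κ : Kernel S S) [IsMarkovKernel κ] (W : ℕ) {π : Measure S} [IsProbabilityMeasure π]
  {ν : Measure S} [IsProbabilityMeasure ν] {ε : ℝ≥0∞} {m : ℕ}

/-- **`Σ_K(s,t) → Σ(s,t)` as `K → ∞`** (summability of the cross-moment series under a Doeblin power). -/
theorem tendsto_chainLagACovTrunc_of_nHit (hπ : Kernel.Invariant κ π) (hε : ε ≠ 0)
    (hmin : ∀ z, ε • ν ≤ nHit κ m z) (hm : 0 < m) {g : S → ℝ} (hg : Measurable g) {C : ℝ}
    (hC : ∀ z, |g z| ≤ C) (s t : Fin (W + 1)) :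
    Tendsto (fun K => chainLagACovTrunc κ π g W K s t) atTop (𝓝 (chainLagACov κ π g W s t)) := by
  have hst : Summable fun k : ℕ => chainLagProdCov κ π g W s t (k + 1) :=
    summable_chainLagCov_of_nHit κ W hπ hε hmin hm hg hC s t
  have hts : Summable fun k : ℕ => chainLagProdCov κ π g W t s (k + 1) :=
    summable_chainLagCov_of_nHit κ W hπ hε hmin hm hg hC t s
  rw [chainLagACov_eq_tsum]
  exact tendsto_const_nhds.add (hst.add hts).hasSum.tendsto_sum_nat

end Population

/-! ## Almost-sure consistency of the plug-in estimator along the chain -/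

section Chain

variable {S : Type*} [MeasurableSpace S]
variable (κ : Kernel S S) [IsMarkovKernel κ] (W : ℕ) {π : Measure S} [IsProbabilityMeasure π]
  {ν : Measure S} [IsProbabilityMeasure ν] {ε : ℝ≥0∞} {m : ℕ}

/-- **`ĉ_N(s,t,k) → c(s,t,k)` almost surely, from every initial law**, for the series `X_i = f̄(x_i)`. -/
theorem ae_tendsto_lagProdCovHat_chain_of_nHit (hπ : Kernel.Invariant κ π) (hε : ε ≠ 0)
    (hmin : ∀ z, ε • ν ≤ nHit κ m z) {f : S → ℝ} (hf : Measurable f) {C : ℝ} (hC : ∀ z, |f z| ≤ C)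
    (μ₀ : Measure S) [IsProbabilityMeasure μ₀] (s t : Fin (W + 1)) (k : ℕ) :
    ∀ᵐ x ∂(Kernel.trajMeasure (X := fun _ : ℕ => S) μ₀
        (fun n : ℕ => κ.comap (fun hh : (i : ↥(Finset.Iic n)) → S => hh ⟨n, Finset.mem_Iic.2 le_rfl⟩)
          (measurable_pi_apply _))),
      Tendsto (fun N : ℕ => lagProdCovHat (fun (i : ℕ) (x : ℕ → S) => f (x i) - ∫ z', f z' ∂π) N s t k x)
        atTop (𝓝 (chainLagProdCov κ π (fun z => f z - ∫ z', f z' ∂π) W s t k)) := by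
  set Pπ := Kernel.trajMeasure (X := fun _ : ℕ => S) π
    (fun n : ℕ => κ.comap (fun hh : (i : ↥(Finset.Iic n)) → S => hh ⟨n, Finset.mem_Iic.2 le_rfl⟩)
      (measurable_pi_apply _)) with hPπ
  obtain ⟨hgm, hgC, -⟩ := centred_observable_bounds π hf hC
  set g : S → ℝ := fun z => f z - ∫ z', f z' ∂π with hgdef
  have hXm : ∀ i : ℕ, Measurable fun x : ℕ → S => g (x i) := fun i => hgm.comp (measurable_pi_apply i)
  -- (1) the four-factor products: a window functional of length `k + W + 1`
  set L : ℕ := k + W with hL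
  have hsL : (s : ℕ) < L + 1 := by have := s.is_lt; omega
  have hkL : k < L + 1 := by omega
  have hktL : k + (t : ℕ) < L + 1 := by have := t.is_lt; omega
  set φ : (Fin (L + 1) → S) → ℝ := fun y =>
    g (y 0) * g (y ⟨s, hsL⟩) * (g (y ⟨k, hkL⟩) * g (y ⟨k + t, hktL⟩)) with hφ
  have hφm : Measurable φ :=
    ((hgm.comp (measurable_pi_apply _)).mul (hgm.comp (measurable_pi_apply _))).mul
      ((hgm.comp (measurable_pi_apply _)).mul (hgm.comp (measurable_pi_apply _)))
  have hprod2 : ∀ a b : S, |g a * g b| ≤ 2 * C * (2 * C) := fun a b => by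
    rw [abs_mul]; exact mul_le_mul (hgC _) (hgC _) (abs_nonneg _) ((abs_nonneg _).trans (hgC a))
  have hφC : ∀ y, |φ y| ≤ 2 * C * (2 * C) * (2 * C * (2 * C)) := fun y => by
    simp only [hφ]
    rw [abs_mul]
    exact mul_le_mul (hprod2 _ _) (hprod2 _ _) (abs_nonneg _)
      ((abs_nonneg _).trans (hprod2 (y 0) (y ⟨s, hsL⟩)))
  have h4 := ae_tendsto_windowAverage_of_nHit κ L hπ hε hmin hφm hφC μ₀
  -- (2) the shifted lag-`t` products: a window functional of length `k + W + 1` too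
  set ψ : (Fin (L + 1) → S) → ℝ := fun y => g (y ⟨k, hkL⟩) * g (y ⟨k + t, hktL⟩) with hψ
  have hψm : Measurable ψ := (hgm.comp (measurable_pi_apply _)).mul (hgm.comp (measurable_pi_apply _))
  have hψC : ∀ y, |ψ y| ≤ 2 * C * (2 * C) := fun y => hprod2 _ _
  have h2 := ae_tendsto_windowAverage_of_nHit κ L hπ hε hmin hψm hψC μ₀
  -- (3) `Γ̂_N(s) → C(s)`
  have hA := ae_tendsto_chain_acovHat_of_nHit κ hπ hε hmin hf hC μ₀ s
  -- the stationary means of (1) and (2)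
  have hmean2 : ∫ x', ψ (windowPath L x' 0) ∂Pπ = autocov κ π g t := by
    simp only [hψ, windowPath_apply, Nat.zero_add]
    rw [hPπ]
    exact chain_autocov hπ hgm hgC k t
  have hmean4 : ∫ x', φ (windowPath L x' 0) ∂Pπ
      = chainLagProdCov κ π g W s t k + autocov κ π g s * autocov κ π g t := by
    -- `∫ (a − C_s)(b − C_t) = ∫ a b − C_s C_t` since `∫ a = C_s`, `∫ b = C_t` (a covariance identity)
    have ha : Measurable fun x' : ℕ → S => g (x' 0) * g (x' s) := (hXm 0).mul (hXm _)
    have hb : Measurable fun x' : ℕ → S => g (x' k) * g (x' (k + t)) := (hXm _).mul (hXm _)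
    have h2a : MemLp (fun x' : ℕ → S => g (x' 0) * g (x' s)) 2 Pπ :=
      MemLp.of_bound ha.aestronglyMeasurable (2 * C * (2 * C))
        (ae_of_all _ fun x' => by rw [Real.norm_eq_abs]; exact hprod2 _ _)
    have h2b : MemLp (fun x' : ℕ → S => g (x' k) * g (x' (k + t))) 2 Pπ :=
      MemLp.of_bound hb.aestronglyMeasurable (2 * C * (2 * C))
        (ae_of_all _ fun x' => by rw [Real.norm_eq_abs]; exact hprod2 _ _)
    have hEa : ∫ x', g (x' 0) * g (x' s) ∂Pπ = autocov κ π g s := by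
      have h := chain_autocov (κ := κ) hπ hgm hgC 0 s
      simp only [Nat.zero_add] at h
      rw [hPπ]; exact h
    have hEb : ∫ x', g (x' k) * g (x' (k + t)) ∂Pπ = autocov κ π g t := by
      rw [hPπ]; exact chain_autocov hπ hgm hgC k t
    have hcov := covariance_eq_sub h2a h2b
    simp only [covariance, Pi.mul_apply] at hcov
    rw [hEa, hEb] at hcov
    simp only [hφ, chainLagProdCov, windowPath_apply, Nat.zero_add, Fin.val_zero, Nat.add_zero, ← hPπ]
    rw [hcov]
    ring
  rw [hmean4] at h4
  rw [hmean2] at h2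
  filter_upwards [h4, h2, hA] with x h4x h2x hAx
  have hlim : Tendsto (fun N : ℕ => (∑ i ∈ range N, φ (windowPath L x i)) / N
      - acovHat (fun (i : ℕ) (x : ℕ → S) => g (x i)) N s x * ((∑ i ∈ range N, ψ (windowPath L x i)) / N))
      atTop (𝓝 (chainLagProdCov κ π g W s t k + autocov κ π g s * autocov κ π g t
        - autocov κ π g s * autocov κ π g t)) := h4x.sub (hAx.mul h2x)
  rw [add_sub_cancel_right] at hlim
  refine hlim.congr fun N => ?_
  rw [lagProdCovHat_eq]
  simp only [hφ, hψ, hgdef, windowPath_apply, Fin.val_zero, Nat.add_zero, Nat.add_assoc]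

/-- **`Σ̂_{N,K}(s,t) → Σ_K(s,t)` almost surely, from every initial law, for all `K, s, t` at once.** -/
theorem ae_tendsto_lagACovTruncHat_chain_of_nHit (hπ : Kernel.Invariant κ π) (hε : ε ≠ 0)
    (hmin : ∀ z, ε • ν ≤ nHit κ m z) {f : S → ℝ} (hf : Measurable f) {C : ℝ} (hC : ∀ z, |f z| ≤ C)
    (μ₀ : Measure S) [IsProbabilityMeasure μ₀] :
    ∀ᵐ x ∂(Kernel.trajMeasure (X := fun _ : ℕ => S) μ₀
        (fun n : ℕ => κ.comap (fun hh : (i : ↥(Finset.Iic n)) → S => hh ⟨n, Finset.mem_Iic.2 le_rfl⟩)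
          (measurable_pi_apply _))),
      ∀ (K : ℕ) (s t : Fin (W + 1)), Tendsto (fun N : ℕ =>
          lagACovTruncHat (fun (i : ℕ) (x : ℕ → S) => f (x i) - ∫ z', f z' ∂π) N K s t x) atTop
        (𝓝 (chainLagACovTrunc κ π (fun z => f z - ∫ z', f z' ∂π) W K s t)) := by
  have hall := ae_all_iff.2 fun s : Fin (W + 1) => ae_all_iff.2 fun t : Fin (W + 1) =>
    ae_all_iff.2 fun k : ℕ => ae_tendsto_lagProdCovHat_chain_of_nHit κ W hπ hε hmin hf hC μ₀ s t k
  filter_upwards [hall] with x hx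
  intro K s t
  unfold lagACovTruncHat chainLagACovTrunc
  exact (hx s t 0).add (tendsto_finsetSum _ fun k _ => (hx s t (k + 1)).add (hx t s (k + 1)))

/-- **THE PLUG-IN VARIANCE WITH THE ESTIMATED GRADIENT IS A.S. CONSISTENT FOR `ℓᵀ Σ_K ℓ`.**  With
`Γ̂_N(t) = acovHat (f̄ ∘ X) N t`, `ℓ̂_N = tauHatGrad W (Γ̂_N(t))_t`, `ℓ = tauHatGrad W (C(t))_t` (`C(0) ≠ 0`):
from every initial law, almost surely, for every `K`,
`Σ_s Σ_t ℓ̂_{N,s} ℓ̂_{N,t} Σ̂_{N,K}(s,t) → Σ_s Σ_t ℓ_s ℓ_t Σ_K(s,t)`. -/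
theorem ae_tendsto_pluginVariance_chain_of_nHit (hπ : Kernel.Invariant κ π) (hε : ε ≠ 0)
    (hmin : ∀ z, ε • ν ≤ nHit κ m z) {f : S → ℝ} (hf : Measurable f) {C : ℝ} (hC : ∀ z, |f z| ≤ C)
    (hσ : autocov κ π (fun z => f z - ∫ z', f z' ∂π) 0 ≠ 0) (μ₀ : Measure S) [IsProbabilityMeasure μ₀] :
    ∀ᵐ x ∂(Kernel.trajMeasure (X := fun _ : ℕ => S) μ₀
        (fun n : ℕ => κ.comap (fun hh : (i : ↥(Finset.Iic n)) → S => hh ⟨n, Finset.mem_Iic.2 le_rfl⟩)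
          (measurable_pi_apply _))),
      ∀ K : ℕ, Tendsto (fun N : ℕ => ∑ s : Fin (W + 1), ∑ t : Fin (W + 1),
          tauHatGrad W (toLp 2 fun u : Fin (W + 1) =>
            acovHat (fun (i : ℕ) (x : ℕ → S) => f (x i) - ∫ z', f z' ∂π) N u x) s
          * tauHatGrad W (toLp 2 fun u : Fin (W + 1) =>
            acovHat (fun (i : ℕ) (x : ℕ → S) => f (x i) - ∫ z', f z' ∂π) N u x) t
          * lagACovTruncHat (fun (i : ℕ) (x : ℕ → S) => f (x i) - ∫ z', f z' ∂π) N K s t x) atTop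
        (𝓝 (∑ s : Fin (W + 1), ∑ t : Fin (W + 1),
          tauHatGrad W (toLp 2 fun u : Fin (W + 1) => autocov κ π (fun z => f z - ∫ z', f z' ∂π) u) s
          * tauHatGrad W (toLp 2 fun u : Fin (W + 1) => autocov κ π (fun z => f z - ∫ z', f z' ∂π) u) t
          * chainLagACovTrunc κ π (fun z => f z - ∫ z', f z' ∂π) W K s t)) := by
  have hSig := ae_tendsto_lagACovTruncHat_chain_of_nHit κ W hπ hε hmin hf hC μ₀
  have hGam := ae_all_iff.2 fun u : ℕ => ae_tendsto_chain_acovHat_of_nHit κ hπ hε hmin hf hC μ₀ u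
  filter_upwards [hSig, hGam] with x hSx hGx
  intro K
  -- the estimated gradient converges coordinatewise
  have hgrad : ∀ i : Fin (W + 1), Tendsto (fun N : ℕ => tauHatGrad W (toLp 2 fun u : Fin (W + 1) =>
      acovHat (fun (i : ℕ) (x : ℕ → S) => f (x i) - ∫ z', f z' ∂π) N u x) i) atTop
      (𝓝 (tauHatGrad W (toLp 2 fun u : Fin (W + 1) => autocov κ π (fun z => f z - ∫ z', f z' ∂π) u) i)) := by
    intro i
    simp only [tauHatGrad, PiLp.toLp_apply]
    by_cases hi : i = 0
    · simp only [hi, if_true]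
      exact ((tendsto_finsetSum _ fun t _ => hGx _).neg).div ((hGx 0).pow 2) (pow_ne_zero 2 hσ)
    · simp only [hi, if_false]
      exact tendsto_const_nhds.div (hGx 0) hσ
  exact tendsto_finsetSum _ fun s _ => tendsto_finsetSum _ fun t _ =>
    ((hgrad s).mul (hgrad t)).mul (hSx K s t)

end Chain

end Summit.Ventures.LatticeQCDFlow.Scoring

end
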